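import Summits.BirchSwinnertonDyer.Rank2.Family81517Conductor
import Mathlib.NumberTheory.LegendreSymbol.QuadraticReciprocity
import HarnessLib

/-!
# p2's `8-15-17` family: `c₆`, the node-tangent discriminant `D = c₄·b₂·(b₂² − 36b₄) = −c₄c₆` of the member modulo
# its multiplicative primes `3, 5, m, r`, and the reciprocity step `(34/m)·(17/r) = −1`

Cell `bsd-rank2` (D-0036), seat `bsd-rank2-eng` GEN 8 — algebraic kernel for the T-r3₂ support `RootNumberFacts`
(local root numbers of `curve j n`; STATUS 2026-08-27 11:2xZ). At a multiplicative prime `ℓ` of the minimal model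
`W = ⟨1, A, 0, qr, 0⟩` (`4A = −17q − 1`, `q = m + 64n²`, `r = m + 289n²`), the reduction is SPLIT iff the tree's
node-tangent quadratic `c₄T² + a₁c₄T − (54b₆ − 3b₂b₄ + a₂c₄)` has a root mod `ℓ`, i.e. iff its discriminant
`D = c₄² + 4c₄(54b₆ − 3b₂b₄ + a₂c₄) = c₄·b₂·(b₂² − 36b₄)` (here `a₁ = 1`, `b₆ = 0`) is a square mod `ℓ`. This file
computes `D` in closed form and its residues:

* `family81517Int_b₂/b₄/b₆/c₆`, `family81517_nodeDisc` — `D = −17·q³·(241m + 4624n²)·(217m − 2312n²)`;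
* `family81517_nodeDisc_mod_three` (`D ≡ m`), `…_mod_five` (`D ≡ m`), `…_mod_m` (`D ≡ 34·(2^{?}·17·…·n⁶)²`),
  `…_mod_r` (`D ≡ 17·□`): so split at `3` iff `m ≡ 1 (3)` iff `q ≡ 1 (3)`, at `5` iff `q ≡ ±1 (5)`, at `m` iff
  `(34/m) = 1`, at `r` iff `(17/r) = 1`;
* `legendreSym_thirtyfour_mul_legendreSym_seventeen` — for primes `m ≡ 3 (mod 8)` and `r ≡ m (mod 17)`:
  `(34/m)·(17/r) = −1` (quadratic reciprocity at `17 ≡ 1 (mod 4)` and `(2/m) = −1`), i.e. `w_m·w_r = −1`.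

THEOREMS ONLY; no `sorry`; standard axioms. PARTITION: none — r_an ≥ 2, summit axis S0; TWIN (D-0056): n/a. B1 honesty:
polynomial identities and quadratic reciprocity; no S0 motion.

References: J. H. Silverman, *AEC* (2009) VII.5 Prop. 5.1, III §1 [SilvermanAEC2009]; D. Rohrlich, *Compositio Math.*
87 (1993) Prop. 2 [Rohrlich1993Compositio]; K. Ireland, M. Rosen, *A classical introduction to modern number theory*
(1990) Ch. 5 Thm. 1 [IrelandRosen1990].
-/

namespace Summit.BirchSwinnertonDyer.Rank2

section NodeQuadratic

variable {m q r : ℕ} {n A : ℤ}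

/-! ### §1 `b₂, b₄, b₆, c₆` and the node discriminant in closed form -/

/-- `b₂ = −17q`. [cite: SilvermanAEC2009, III §1] -/
theorem family81517Int_b₂ (hA : 4 * A = -17 * q - 1) :
    (⟨1, A, 0, (q : ℤ) * r, 0⟩ : WeierstrassCurve ℤ).b₂ = -17 * q := by
  simp only [WeierstrassCurve.b₂]; linear_combination hA

/-- `b₄ = 2qr`. [cite: SilvermanAEC2009, III §1] -/
theorem family81517Int_b₄ : (⟨1, A, 0, (q : ℤ) * r, 0⟩ : WeierstrassCurve ℤ).b₄ = 2 * q * r := by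
  simp only [WeierstrassCurve.b₄]; ring

/-- `b₆ = 0`. [cite: SilvermanAEC2009, III §1] -/
theorem family81517Int_b₆ : (⟨1, A, 0, (q : ℤ) * r, 0⟩ : WeierstrassCurve ℤ).b₆ = 0 := by
  simp [WeierstrassCurve.b₆]

/-- `c₆ = 17 q² (217m − 2312n²)` (`= 17q²(289q − 72r)`). [cite: SilvermanAEC2009, III §1] -/
theorem family81517Int_c₆ (hq_eq : (q : ℤ) = m + 64 * n ^ 2) (hr_eq : (r : ℤ) = m + 289 * n ^ 2)
    (hA : 4 * A = -17 * q - 1) :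
    (⟨1, A, 0, (q : ℤ) * r, 0⟩ : WeierstrassCurve ℤ).c₆ = 17 * (q : ℤ) ^ 2 * (217 * m - 2312 * n ^ 2) := by
  simp only [WeierstrassCurve.c₆, WeierstrassCurve.b₂, WeierstrassCurve.b₄, WeierstrassCurve.b₆]
  linear_combination (-(1 + 4 * A) ^ 2 - (1 + 4 * A) * (-17 * (q : ℤ)) - (17 * (q : ℤ)) ^ 2 + 72 * (q : ℤ) * r) *
    hA + 17 * (q : ℤ) ^ 2 * (289 * hq_eq - 72 * hr_eq)

/-- **The node discriminant**: with `a₁ = 1`, `a₂ = A`, `b₆ = 0`,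
`c₄² + 4c₄(54b₆ − 3b₂b₄ + a₂c₄) = c₄·b₂·(b₂² − 36b₄) = −17·q³·(241m + 4624n²)·(217m − 2312n²)`.
[cite: SilvermanAEC2009, VII.5 Prop. 5.1(b)] -/
theorem family81517_nodeDisc (hq_eq : (q : ℤ) = m + 64 * n ^ 2) (hr_eq : (r : ℤ) = m + 289 * n ^ 2)
    (hA : 4 * A = -17 * q - 1) :
    let W₀ : WeierstrassCurve ℤ := ⟨1, A, 0, (q : ℤ) * r, 0⟩
    W₀.c₄ ^ 2 + 4 * W₀.c₄ * (54 * W₀.b₆ - 3 * W₀.b₂ * W₀.b₄ + A * W₀.c₄) =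
      -17 * (q : ℤ) ^ 3 * (241 * m + 4624 * n ^ 2) * (217 * m - 2312 * n ^ 2) := by
  intro W₀
  rw [family81517Int_c₄ hq_eq hr_eq hA, family81517Int_b₂ hA, family81517Int_b₄, family81517Int_b₆]
  linear_combination ((q : ℤ) * (241 * m + 4624 * n ^ 2)) ^ 2 * hA +
    408 * (q : ℤ) ^ 3 * (241 * (m : ℤ) + 4624 * n ^ 2) * hr_eq

/-! ### §2 The node discriminant modulo `3`, `5`, `m`, `r` -/

/-- `D ≡ m (mod 3)` when `3 ∣ n` (so: a square mod `3` iff `m ≡ 0, 1`; for the family `m ≢ 0`).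
[cite: Rohrlich1993Compositio, Prop. 2(ii)] -/
theorem family81517_nodeDisc_mod_three (hq_eq : (q : ℤ) = m + 64 * n ^ 2) (h3 : (3 : ℤ) ∣ n) :
    ((-17 * (q : ℤ) ^ 3 * (241 * m + 4624 * n ^ 2) * (217 * m - 2312 * n ^ 2) : ℤ) : ZMod 3) = (m : ZMod 3) := by
  have hn : ((n : ℤ) : ZMod 3) = 0 := (ZMod.intCast_zmod_eq_zero_iff_dvd n 3).mpr h3
  have hq : (q : ZMod 3) = (m : ZMod 3) := by
    have h := congrArg (fun z : ℤ ↦ (z : ZMod 3)) hq_eq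
    push_cast at h
    rw [h, hn]; ring
  push_cast; rw [hn, hq]
  generalize (m : ZMod 3) = x
  revert x; decide

/-- `D ≡ m (mod 5)` when `5 ∣ n` (so: a square mod `5` iff `m ≡ 0, ±1`). [cite: Rohrlich1993Compositio, Prop. 2(ii)] -/
theorem family81517_nodeDisc_mod_five (hq_eq : (q : ℤ) = m + 64 * n ^ 2) (h5 : (5 : ℤ) ∣ n) :
    ((-17 * (q : ℤ) ^ 3 * (241 * m + 4624 * n ^ 2) * (217 * m - 2312 * n ^ 2) : ℤ) : ZMod 5) = (m : ZMod 5) := by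
  have hn : ((n : ℤ) : ZMod 5) = 0 := (ZMod.intCast_zmod_eq_zero_iff_dvd n 5).mpr h5
  have hq : (q : ZMod 5) = (m : ZMod 5) := by
    have h := congrArg (fun z : ℤ ↦ (z : ZMod 5)) hq_eq
    push_cast at h
    rw [h, hn]; ring
  push_cast; rw [hn, hq]
  generalize (m : ZMod 5) = x
  revert x; decide

/-- `D ≡ 34·(1183744·n⁵)² (mod m)` (`q ≡ 64n²`, `241m + 4624n² ≡ (68n)²`, `217m − 2312n² ≡ −2·34²n²`): a square mod `m`
iff `34` is. [cite: Rohrlich1993Compositio, Prop. 2(ii)] -/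
theorem family81517_nodeDisc_mod_m (hq_eq : (q : ℤ) = m + 64 * n ^ 2) :
    ((-17 * (q : ℤ) ^ 3 * (241 * m + 4624 * n ^ 2) * (217 * m - 2312 * n ^ 2) : ℤ) : ZMod m) =
      34 * ((1183744 : ZMod m) * (n : ZMod m) ^ 5) ^ 2 := by
  have hq : (q : ZMod m) = 64 * (n : ZMod m) ^ 2 := by
    have h := congrArg (fun z : ℤ ↦ (z : ZMod m)) hq_eq
    push_cast at h
    rw [h, ZMod.natCast_self]; ring
  push_cast; rw [hq, ZMod.natCast_self]
  ring

/-- `D ≡ 17·(219459375·n⁵)² (mod r)` (`m ≡ −289n²`, `q ≡ −225n²`, both linear factors `≡ −255²n²`): a square mod `r` iff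
`17` is. [cite: Rohrlich1993Compositio, Prop. 2(ii)] -/
theorem family81517_nodeDisc_mod_r (hq_eq : (q : ℤ) = m + 64 * n ^ 2) (hr_eq : (r : ℤ) = m + 289 * n ^ 2) :
    ((-17 * (q : ℤ) ^ 3 * (241 * m + 4624 * n ^ 2) * (217 * m - 2312 * n ^ 2) : ℤ) : ZMod r) =
      17 * ((219459375 : ZMod r) * (n : ZMod r) ^ 5) ^ 2 := by
  have hm : (m : ZMod r) = -289 * (n : ZMod r) ^ 2 := by
    have e : (m : ℤ) = r - 289 * n ^ 2 := by rw [hr_eq]; ring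
    have h := congrArg (fun z : ℤ ↦ (z : ZMod r)) e
    push_cast at h
    rw [h, ZMod.natCast_self]; ring
  have hq : (q : ZMod r) = -225 * (n : ZMod r) ^ 2 := by
    have h := congrArg (fun z : ℤ ↦ (z : ZMod r)) hq_eq
    push_cast at h
    rw [h, hm]; ring
  push_cast; rw [hq, hm]
  ring

/-! ### §3 The reciprocity step `(34/m)·(17/r) = −1` -/

/-- **`(34/m)·(17/r) = −1`** for primes `m ≡ 3 (mod 8)` and `r ≡ m ≢ 0 (mod 17)`: `(34/m) = (2/m)(17/m) = −(m/17)` and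
`(17/r) = (r/17) = (m/17)` by quadratic reciprocity at `17 ≡ 1 (mod 4)`. For the family this is `w_m·w_r = −1`.
[cite: IrelandRosen1990, Ch. 5 Thm. 1] -/
theorem legendreSym_thirtyfour_mul_legendreSym_seventeen (m r : ℕ) [Fact m.Prime] [Fact r.Prime]
    (hm8 : m % 8 = 3) (hr2 : r ≠ 2) (hrm : (r : ℤ) % 17 = (m : ℤ) % 17) (hm17 : ((m : ℤ) : ZMod 17) ≠ 0) :
    legendreSym m 34 * legendreSym r 17 = -1 := by
  haveI : Fact (Nat.Prime 17) := ⟨by norm_num⟩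
  have hm2 : m ≠ 2 := by omega
  have h2 : legendreSym m 2 = -1 := by
    rw [legendreSym.at_two hm2, ZMod.χ₈_nat_eq_if_mod_eight]
    have : m % 2 = 1 := by omega
    rw [if_neg (by omega), if_neg (by omega)]
  have hrec : legendreSym m (17 : ℕ) = legendreSym 17 (m : ℕ) :=
    legendreSym.quadratic_reciprocity_one_mod_four (p := 17) (q := m) (by norm_num) hm2
  have hrec' : legendreSym r (17 : ℕ) = legendreSym 17 (r : ℕ) :=
    legendreSym.quadratic_reciprocity_one_mod_four (p := 17) (q := r) (by norm_num) hr2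
  have h34 : legendreSym m 34 = -legendreSym 17 m := by
    have e1 : legendreSym m 17 = legendreSym 17 m := by exact_mod_cast hrec
    rw [show (34 : ℤ) = 2 * 17 by norm_num, legendreSym.mul, h2, e1]; ring
  have h17 : legendreSym r 17 = legendreSym 17 m := by
    have e1 : legendreSym r 17 = legendreSym 17 r := by exact_mod_cast hrec'
    rw [e1, legendreSym.mod 17 (r : ℤ), legendreSym.mod 17 (m : ℤ)]
    exact_mod_cast congrArg (legendreSym 17) hrm
  rw [h34, h17]
  have hsq := legendreSym.sq_one 17 hm17
  linear_combination -hsq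

end NodeQuadratic

end Summit.BirchSwinnertonDyer.Rank2
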